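import Mathlib.Algebra.Homology.DerivedCategory.Ext.MapBijective
import Mathlib.CategoryTheory.Adjunction.Additive
import HarnessLib

/-!
# The canonical Eckmann–Shapiro isomorphism `Extⁿ(L A, B) ≅ Extⁿ(A, R B)`: `x ↦ η_A ≫ R(x)`

Topic `Algebra/Homology`; namespace `Literature.Algebra.Homology.ExtAdjunction`.  Pure homological
algebra for Mathlib's derived-category `Abelian.Ext`; no named fact, no `sorry`.  Companion of
`ExtAdjunction` (same isomorphism, built there by recursion on the degree); here the map is the
CANONICAL one, so that its compatibility with Yoneda composition is immediate:

for an adjunction `L : C ⥤ D ⊣ R : D ⥤ C` with `R` exact and `L` preserving monomorphisms,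
  `extAdjunctionMap adj A B n : Extⁿ_D(L A, B) →+ Extⁿ_C(A, R B)`,  `x ↦ [η_A] ∘ R(x)`
(`Ext.mapExactFunctor R` followed by precomposition with the class of the unit `η_A : A ⟶ R L A`).

* `extAdjunctionMap_comp_mk₀`, `extAdjunctionMap_comp` (compatibility with composition:
  `Φ(x ∘ z) = Φ(x) ∘ R(z)`), `extAdjunctionMap_comp_extClass` (with connecting classes),
  `extAdjunctionMap_mk₀` (degree `0` = `adj.homEquiv`).
* **`extAdjunctionMap_bijective`** (`D` with enough injectives): by induction on `n` over an
  injective presentation, exactly as Mathlib's `Functor.mapExt_bijective_of_preservesInjectiveObjects`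
  (four lemma `AddMonoidHom.bijective_of_surjective_of_bijective_of_right_exact`); `R` carries
  injectives to injectives because `L` preserves monomorphisms (`Adjunction.map_injective`).
* `extAdjunctionAddEquiv` — the resulting `Extⁿ(L A, B) ≃+ Extⁿ(A, R B)` (Weibel Lemma 6.3.2;
  Harari Remark 16.13 for `Res ⊣ Coind`).

## References
* C. A. Weibel, *An introduction to homological algebra*, CUP (1994), Lemma 6.3.2. [Weibel1994]
* D. Harari, *Galois Cohomology and Class Field Theory* (2020), Remark 16.13, Prop. 16.18. [Harari2020]
-/

-- CITATION-FIX (2026-08-27, door-c4 g13; referee flag Q-g51-1, held copy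
-- `book:harari2017-galois-cohomology-class-field-theory`): earlier revisions cited "Harari Prop. 16.17"
-- for Shapiro-type isomorphisms of `Ext`.  Prop. 16.17 (p. 272) is the compatibility of the cup-product
-- with the `Ext` pairing; the printed homes are Remark 16.13 (p. 269: `Ext_G^i(A, I_G^H(B)) ≃
-- Ext_H^i(A, B)`) and Proposition 1.39 (p. 48, first variable; for `H` open by §4.3 (4), p. 97);
-- Prop. 16.18 (p. 272) is the compatibility of the pairings with these isomorphisms and with the
-- corestriction.  Citations corrected; declarations unchanged.

noncomputable section

universe w v v' u u'

namespace Literature.Algebra.Homology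

namespace ExtAdjunction

open CategoryTheory CategoryTheory.Limits CategoryTheory.Abelian

variable {C : Type u} [Category.{v} C] [Abelian C] [HasExt.{w} C]
  {D : Type u'} [Category.{v'} D] [Abelian D] [HasExt.{w} D]
  {L : C ⥤ D} {R : D ⥤ C} (adj : L ⊣ R) [R.Additive]
  [PreservesFiniteLimits R] [PreservesFiniteColimits R]

/-- The unit `η_A : A ⟶ R (L A)` of the adjunction, typed on `R.obj (L.obj A)` (= `adj.homEquiv (𝟙 _)`).
[cite: Weibel1994, Lemma 6.3.2] -/
def unitHom (A : C) : A ⟶ R.obj (L.obj A) := adj.homEquiv A (L.obj A) (𝟙 _)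

omit [Abelian C] [HasExt C] [Abelian D] [HasExt D] [R.Additive] [PreservesFiniteLimits R]
  [PreservesFiniteColimits R] in
/-- `η_A ≫ R f = adj.homEquiv f`. [cite: Weibel1994, Lemma 6.3.2] -/
theorem unitHom_comp_map (A : C) {B : D} (f : L.obj A ⟶ B) :
    unitHom adj A ≫ R.map f = adj.homEquiv A B f := by
  rw [unitHom, ← adj.homEquiv_naturality_right, Category.id_comp]

/-- **The canonical Eckmann–Shapiro map `Extⁿ(L A, B) →+ Extⁿ(A, R B)`, `x ↦ [η_A] ∘ R(x)`.**
[cite: Weibel1994, Lemma 6.3.2] -/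
def extAdjunctionMap (A : C) (B : D) (n : ℕ) : Ext (L.obj A) B n →+ Ext A (R.obj B) n :=
  ((Ext.mk₀ (unitHom adj A)).precomp (R.obj B) (zero_add n)).comp (R.mapExtAddHom (L.obj A) B n)

/-- Formula. [cite: Weibel1994, Lemma 6.3.2] -/
theorem extAdjunctionMap_apply (A : C) (B : D) (n : ℕ) (x : Ext (L.obj A) B n) :
    extAdjunctionMap adj A B n x =
      (Ext.mk₀ (unitHom adj A)).comp (x.mapExactFunctor R) (zero_add n) := rfl

/-- Degree `0`: `Φ([f]) = [adj.homEquiv f]`. [cite: Weibel1994, Lemma 6.3.2] -/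
@[simp]
theorem extAdjunctionMap_mk₀ (A : C) (B : D) (f : L.obj A ⟶ B) :
    extAdjunctionMap adj A B 0 (Ext.mk₀ f) = Ext.mk₀ (adj.homEquiv A B f) := by
  rw [extAdjunctionMap_apply, Ext.mapExactFunctor_mk₀, Ext.mk₀_comp_mk₀, unitHom_comp_map]

/-- **Compatibility with composition**: `Φ(x ∘ z) = Φ(x) ∘ R(z)`. [cite: Harari2020, Proposition 16.18] -/
theorem extAdjunctionMap_comp (A : C) {B B' : D} {a b c : ℕ} (x : Ext (L.obj A) B a)
    (z : Ext B B' b) (h : a + b = c) :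
    extAdjunctionMap adj A B' c (x.comp z h) =
      (extAdjunctionMap adj A B a x).comp (z.mapExactFunctor R) h := by
  rw [extAdjunctionMap_apply, extAdjunctionMap_apply, Ext.mapExactFunctor_comp,
    ← Ext.comp_assoc (Ext.mk₀ (unitHom adj A)) (x.mapExactFunctor R) (z.mapExactFunctor R)
      (zero_add a) h (by omega)]

/-- In particular `Φ(x ∘ [g]) = Φ(x) ∘ [R g]`. [cite: Harari2020, Proposition 16.18] -/
theorem extAdjunctionMap_comp_mk₀ (A : C) {B B' : D} {n : ℕ} (x : Ext (L.obj A) B n) (g : B ⟶ B') :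
    extAdjunctionMap adj A B' n (x.comp (Ext.mk₀ g) (add_zero n)) =
      (extAdjunctionMap adj A B n x).comp (Ext.mk₀ (R.map g)) (add_zero n) := by
  rw [extAdjunctionMap_comp, Ext.mapExactFunctor_mk₀]

/-- And `Φ(x ∘ [S]) = Φ(x) ∘ [R S]` for the class of a short exact sequence (`R` exact).
[cite: Harari2020, Proposition 16.18] -/
theorem extAdjunctionMap_comp_extClass (A : C) {S : ShortComplex D} (hS : S.ShortExact) {n : ℕ}
    (x : Ext (L.obj A) S.X₃ n) :
    extAdjunctionMap adj A S.X₁ (n + 1) (x.comp hS.extClass rfl) =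
      (extAdjunctionMap adj A S.X₃ n x).comp (hS.map_of_exact R).extClass rfl := by
  rw [extAdjunctionMap_comp, Ext.mapExactFunctor_extClass]
  rfl

variable [L.PreservesMonomorphisms] [EnoughInjectives D]

/-- **The canonical Eckmann–Shapiro map is bijective** (`L` preserves monomorphisms, `R` exact, `D`
with enough injectives): dimension shifting over an injective presentation of `B`, as in Mathlib's
`Functor.mapExt_bijective_of_preservesInjectiveObjects`. [cite: Weibel1994, Lemma 6.3.2] -/
theorem extAdjunctionMap_bijective (A : C) (B : D) (n : ℕ) :
    Function.Bijective (extAdjunctionMap adj A B n) := by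
  induction n generalizing B with
  | zero =>
    have h : ⇑(extAdjunctionMap adj A B 0) = Ext.mk₀ ∘ adj.homEquiv A B ∘ Ext.addEquiv₀ := by
      ext x
      obtain ⟨f, rfl⟩ := (Ext.mk₀_bijective _ _).2 x
      have hf : Ext.addEquiv₀ (Ext.mk₀ f) = f := by
        rw [← Ext.addEquiv₀_symm_apply, AddEquiv.apply_symm_apply]
      simp only [Function.comp_apply, extAdjunctionMap_mk₀, hf]
    rw [h]
    exact (Ext.mk₀_bijective _ _).comp ((adj.homEquiv A B).bijective.comp Ext.addEquiv₀.bijective)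
  | succ n hn =>
    let I : InjectivePresentation B := Classical.arbitrary _
    let S : ShortComplex D := ShortComplex.mk _ _ (cokernel.condition I.f)
    haveI : Injective S.X₂ := I.injective
    have hS : S.ShortExact := { exact := ShortComplex.exact_cokernel I.f }
    have hRS : (S.map R).ShortExact := hS.map_of_exact R
    haveI : Injective (S.map R).X₂ := adj.map_injective _ I.injective
    refine AddMonoidHom.bijective_of_surjective_of_bijective_of_right_exact
      ((Ext.mk₀ S.g).postcomp (L.obj A) (add_zero n)) (hS.extClass.postcomp (L.obj A) rfl)
      ((Ext.mk₀ (S.map R).g).postcomp A (add_zero n)) (hRS.extClass.postcomp A rfl)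
      (extAdjunctionMap adj A S.X₂ n) (extAdjunctionMap adj A S.X₃ n)
      (extAdjunctionMap adj A S.X₁ (n + 1)) ?_ ?_
      ((ShortComplex.ab_exact_iff_function_exact _).mp
        (Ext.covariant_sequence_exact₃' (L.obj A) hS n (n + 1) rfl))
      ((ShortComplex.ab_exact_iff_function_exact _).mp
        (Ext.covariant_sequence_exact₃' A hRS n (n + 1) rfl))
      (hn _).surjective (hn _) ?_ ?_
    · ext x
      exact (extAdjunctionMap_comp_mk₀ adj A x S.g).symm
    · ext x
      exact (extAdjunctionMap_comp_extClass adj A hS x).symm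
    · intro y
      exact Ext.covariant_sequence_exact₁ (L.obj A) hS y (Ext.eq_zero_of_injective _) rfl
    · intro y
      exact Ext.covariant_sequence_exact₁ A hRS y (Ext.eq_zero_of_injective _) rfl

/-- **`Extⁿ(L A, B) ≃+ Extⁿ(A, R B)`, canonically.** [cite: Weibel1994, Lemma 6.3.2][cite: Harari2020, Remark 16.13] -/
def extAdjunctionAddEquiv (A : C) (B : D) (n : ℕ) : Ext (L.obj A) B n ≃+ Ext A (R.obj B) n :=
  AddEquiv.ofBijective (extAdjunctionMap adj A B n) (extAdjunctionMap_bijective adj A B n)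

/-- Formula. [cite: Weibel1994, Lemma 6.3.2] -/
@[simp]
theorem extAdjunctionAddEquiv_apply (A : C) (B : D) (n : ℕ) (x : Ext (L.obj A) B n) :
    extAdjunctionAddEquiv adj A B n x =
      (Ext.mk₀ (unitHom adj A)).comp (x.mapExactFunctor R) (zero_add n) := rfl

end ExtAdjunction

end Literature.Algebra.Homology
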